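import Literature.Analysis.FluidPDE.FractionalNSPrescribedEnergyHolds
import Literature.Barriers.NavierStokesRegularity.HypodissipativeLerayNonuniquenessDeRosaProofs
import HarnessLib

/-!
# Discharges of named facts of `HypodissipativeLerayNonuniqueness.lean`

`Literature/Barriers/NavierStokesRegularity/HypodissipativeLerayNonuniquenessHolds.lean` —
proofs-only sibling of `HypodissipativeLerayNonuniqueness.lean` (no definitions, no named
facts). Each theorem below closes a named fact `X : Prop` of that file as `X_holds : X` by
composing an ACCEPTED reduction theorem of the tree with the ACCEPTED unconditional `_holds`
discharges of all of its hypotheses; nothing is re-proved and no statement is changed.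
Recorded by the librarian sweep g25 (2026-08-16, pass 5c: facts dischargeable in one line from
the tree's own lemmas), so that the facts census, `#h21_route_deps` and the cone guardrail see
these facts as theorems.

Discharged here:

* `HypodissipativeLerayNonuniqueness_holds` := `hypodissipativeLerayNonuniqueness_of_thm21`
  `DeRosa2019_thm21_holds` (`HypodissipativeLerayNonuniquenessDeRosaProofs.lean`).

## References

* [AlbrittonBrueColombo2022AnnMath] — see `lean/references.bib` and the docstring of the fact in `HypodissipativeLerayNonuniqueness.lean`.
* [AlbrittonColombo2023] — see `lean/references.bib` and the docstring of the fact in `HypodissipativeLerayNonuniqueness.lean`.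
* [BuckmasterVicol2019AnnMath] — see `lean/references.bib` and the docstring of the fact in `HypodissipativeLerayNonuniqueness.lean`.
* [BulutHuynhPalasek2022] — see `lean/references.bib` and the docstring of the fact in `HypodissipativeLerayNonuniqueness.lean`.
* [ColomboDelellisDerosa2018] — see `lean/references.bib` and the docstring of the fact in `HypodissipativeLerayNonuniqueness.lean`.
* [Derosa2018] — see `lean/references.bib` and the docstring of the fact in `HypodissipativeLerayNonuniqueness.lean`.
* [Gorini2023] — see `lean/references.bib` and the docstring of the fact in `HypodissipativeLerayNonuniqueness.lean`.
* [HouWangYang2025] — see `lean/references.bib` and the docstring of the fact in `HypodissipativeLerayNonuniqueness.lean`.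
* [JiaSverak2015] — see `lean/references.bib` and the docstring of the fact in `HypodissipativeLerayNonuniqueness.lean`.
* [KhorMiaoSu2023] — see `lean/references.bib` and the docstring of the fact in `HypodissipativeLerayNonuniqueness.lean`.
* [KwonOzanski2022] — see `lean/references.bib` and the docstring of the fact in `HypodissipativeLerayNonuniqueness.lean`.
* [LangeRehmeierSchenke2024] — see `lean/references.bib` and the docstring of the fact in `HypodissipativeLerayNonuniqueness.lean`.
* [LuoTiti2020] — see `lean/references.bib` and the docstring of the fact in `HypodissipativeLerayNonuniqueness.lean`.
* [Wiedemann2018] — see `lean/references.bib` and the docstring of the fact in `HypodissipativeLerayNonuniqueness.lean`.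
-/

namespace Literature.Barriers.NavierStokesRegularity

/-- **Discharge of the named fact `HypodissipativeLerayNonuniqueness`**
(`HypodissipativeLerayNonuniqueness.lean`): Barrier (Colombo–De Lellis–De Rosa 2018 / De Rosa
2019): for weak dissipation the Leray–Hopf class is not a uniqueness class. For every `α ∈ (0,
1/3)` there is a divergence-free `v̄ ∈ L²(𝕋³)` admitting infinitely many Leray solutions
(distributional … — obtained as `hypodissipativeLerayNonuniqueness_of_thm21` applied to the
tree's unconditional discharge `DeRosa2019_thm21_holds` of its hypothesis (reduction in
`HypodissipativeLerayNonuniquenessDeRosaProofs.lean`).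
[cite: Derosa2018, §1 Thm. 1.2]
[cite: ColomboDelellisDerosa2018, §1 Thm. 1.2]
[cite: ColomboDelellisDerosa2018, §1 Thm. 1.1 and (2)–(3)]
[cite: Derosa2018, §1 Thm. 1.1]
[cite: ColomboDelellisDerosa2018, §1 p. 4]
[cite: JiaSverak2015, Thm. 3 (conditional)]
[cite: BulutHuynhPalasek2022, §1 (after Thm. 1)]
[cite: Derosa2018, §2 p. 5 (property (v) of 𝓔_K)]
[cite: Derosa2018, §1 Thm. 1.2 (a)]
[cite: ColomboDelellisDerosa2018, §1 Thm. 1.3 (c)]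
[cite: Wiedemann2018, §2 Thm. 1]
[cite: Gorini2023, §1 p. 2]
[cite: Derosa2018, §2 Thm. 2.1]
[cite: ColomboDelellisDerosa2018, §1 Thms. 1.2–1.3]
[cite: ColomboDelellisDerosa2018, §1 Thm. 1.1 and the paragraph after Thm. 1.3]
[cite: LuoTiti2020, §1]
[cite: Derosa2018, §1 p. 3]
[cite: BuckmasterVicol2019AnnMath, Thm. 1.2]
[cite: AlbrittonBrueColombo2022AnnMath, Thm. 1.2]
[cite: KwonOzanski2022, §1 p. 6]
[cite: AlbrittonColombo2023, Thm. 1.1]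
[cite: KhorMiaoSu2023, Thm. 1.2 and Rmk. 2]
[cite: HouWangYang2025, Thm. 1]
[cite: LangeRehmeierSchenke2024, §1 (State of the art: deterministic regime)]
[cite: Gorini2023, §1 Cor. and Thm. (density of wild initial data)] -/
theorem HypodissipativeLerayNonuniqueness_holds :
    HypodissipativeLerayNonuniqueness :=
  hypodissipativeLerayNonuniqueness_of_thm21 Literature.Analysis.FluidPDE.DeRosa2019_thm21_holds

end Literature.Barriers.NavierStokesRegularity
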